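/-
Origin: expansion seat `planner-pub-hodgecm-pv11-g5-0`, handover #2 2026-08-18T07:50:41Z (`HOME/pub-hodgecm-pv11-g5/lean/Pv11g5/SeesawFubini.lean`, md5 2f178ae2, 356 lines);
landed by the gen-7 packager in gate run 26 as `HodgeCM/PerL34/SeesawFubini.lean` (import ^import Pv[0-9]+g[0-9]+\.→import HodgeCM.PerL34. ×1).
-/
/-
Origin: HOME/pub-hodgecm-pv11-g5/lean/Pv11g5/SeesawFubini.lean — session planner-pub-hodgecm-pv11-g5-0
(unit pub-hodgecm-pv11-g5, DAG-NODE PROVER #11 gen 5; lineage pv11 = route (E) / N17 seesaw / seam S5, torus side).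
Intended final place (packager's call): `HodgeCM/PerL34/SeesawFubini.lean`.
NEW, ADDITIVE LEAF; imports my run-26 file `Pv11g5.SeesawTorus` (↦ `HodgeCM.PerL34.SeesawTorus`, the ONLY import
to rewrite) and Mathlib.
KIND: KERNEL — complete proofs, no new axioms, nothing cited, nothing posited.  ONE typed instance HYPOTHESIS,
`[SecondCountableTopology (AdeleRing (𝓞 L) L)]`, discharged in the kernel by prl1-g4's instance
`HodgeCM.Adelic.secondCountableTopology_adeleRing` (`AdelicUnitaryModel.lean`, run-26 CLAIM #5) by instance
resolution once both files are in the tree — it is NOT a cited fact and nothing here depends on its proof.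
-/
import Summits.HodgeConjecture.HodgeCM.PerL34.SeesawTorus_3
import Mathlib.MeasureTheory.Integral.Prod

/-!
# `dt = du₁ du₂` on `[T] = [U(W₁)] × [U(W₂)]` — PerL v5 l. 335 for the genuine seesaw torus

VERBATIM (PerL v5 `paper.tex` l. 335, proof of Lemma 3.4): "Pairing with `Θ_{φ₃⊗φ₄}` and unfolding gives
(eq:quadruple); (eq:seesaw) follows by integrating over `[T] = [U(W₁)]×[U(W₂)]` (all integrals over compact sets
of continuous functions)."  And l. 306: "`P_{T,χ}(F) := ∫_{[T]} F(t)χ(t) dt` for continuous `F` on `[U(W)]`."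

gen-1 `HodgeCM.PerL34.Seesaw.ThetaSeesawData.eq_seesaw` proved (eq:seesaw) as Fubini over an ABSTRACT product
measure `ν₁.prod ν₂`; `SeesawTorus.lean` (run 26) built the GENUINE `[T] = T(L₀)\T(𝔸)` with its Haar probability
`dt = SeesawTorus.probHaarQuot` and the topological-group isomorphism `SeesawTorus.quotEquiv : [T] ≃ₜ* [U(W₁)] × [U(W₂)]`.
This file supplies the MEASURE half of "`[T] = [U(W₁)]×[U(W₂)]`":

* §1 second countability of `𝔸_L^×`, `U(W_j)(𝔸) = relNormOneIdeles K L`, `[U(W_j)]`, `T(𝔸)`, `[T]` from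
  `[SecondCountableTopology (AdeleRing (𝓞 L) L)]` — this is what makes `[U(W₁)] × [U(W₂)]` a BOREL space for the
  product σ-algebra (`Prod.borelSpace`), i.e. what `MeasureTheory.Measure.prod` / Fubini need; with it the Borel
  σ-algebra of `T(𝔸)` is the product σ-algebra (`SeesawTorus.measurableSpace_eq_prod`).
* §2 **`dt = du₁ du₂`**: `(probHaarQuot K L).map (quotEquiv K L) = (probHaarRelNormOneQuot K L).prod
  (probHaarRelNormOneQuot K L)` (`SeesawTorus.map_quotEquiv_probHaarQuot`, by uniqueness of the Haar probability
  measure), `MeasurePreserving` in both directions, and the marginals `dt ↦ du_j` under `[T] → [U(W_j)]`.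
* §3 **Fubini on `[T]`**: `∫_{[T]} F dt = ∫_{[U(W₁)]} ∫_{[U(W₂)]} F(u₁u₂) du₂ du₁` for integrable — in particular
  continuous — `F` (`SeesawTorus.integral_eq_integral_integral`, both orders), and the toric-period form
  `∫_{[T]} F(t) χ₁₂(t) dt = ∫∫ F(u₁,u₂) χ′₁(u₁) χ′₂(u₂) du₂ du₁` for `χ₁₂ = χ′₁ ⊠ χ′₂`
  (`SeesawTorus.integral_mul_charPair`) — the sentence of l. 335 on PerL's own torus.
-/

set_option autoImplicit false

noncomputable section

open MeasureTheory Topology Set Function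
open scoped NumberField

namespace NumberField

/-! ## §1  Second countability -/

section SecondCountable

variable (K L : Type) [Field K] [Field L] [NumberField L] [Algebra K L] [FiniteDimensional K L]
variable [SecondCountableTopology (AdeleRing (𝓞 L) L)]

/-- `𝔸_L^×` is second countable if `𝔸_L` is (it embeds into `𝔸_L × 𝔸_Lᵐᵒᵖ`). -/
instance secondCountableTopology_ideleGroup : SecondCountableTopology (ideleGroup L) := by
  haveI : SecondCountableTopology (AdeleRing (𝓞 L) L)ᵐᵒᵖ :=
    MulOpposite.opHomeomorph.symm.secondCountableTopology
  exact Units.isEmbedding_embedProduct.secondCountableTopology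

/-- `U(W_j)(𝔸) = U(1)_{L/K}(𝔸_K)` is second countable. -/
instance secondCountableTopology_relNormOneIdeles : SecondCountableTopology (relNormOneIdeles K L) :=
  (Topology.IsEmbedding.subtypeVal :
    Topology.IsEmbedding (Subtype.val : relNormOneIdeles K L → ideleGroup L)).secondCountableTopology

/-- `[U(W_j)]` is second countable. -/
instance secondCountableTopology_relNormOneQuot :
    SecondCountableTopology (relNormOneIdeles K L ⧸ relNormOneRat K L) :=
  inferInstance

namespace SeesawTorus

/-- `T(𝔸)` is second countable. -/
instance secondCountableTopology : SecondCountableTopology (SeesawTorus K L) :=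
  inferInstanceAs (SecondCountableTopology (relNormOneIdeles K L × relNormOneIdeles K L))

/-- `[T]` is second countable. -/
instance secondCountableTopology_quot : SecondCountableTopology (SeesawTorus K L ⧸ rat K L) :=
  inferInstance

/-- With second countability the Borel σ-algebra of `T(𝔸)` (the one `SeesawTorus` carries) IS the product
σ-algebra of the two Borel factors. -/
theorem measurableSpace_eq_prod :
    (instMeasurableSpace K L : MeasurableSpace (SeesawTorus K L)) =
      (Prod.instMeasurableSpace : MeasurableSpace (relNormOneIdeles K L × relNormOneIdeles K L)) :=
  (BorelSpace.measurable_eq (α := relNormOneIdeles K L × relNormOneIdeles K L)).symm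

/-- Hence a map into `T(𝔸)` is measurable iff its two components are. -/
theorem measurable_iff {X : Type} [MeasurableSpace X] (f : X → SeesawTorus K L) :
    Measurable f ↔ Measurable (fun x => fst K L (f x)) ∧ Measurable (fun x => snd K L (f x)) := by
  have h := measurableSpace_eq_prod K L
  constructor
  · intro hf
    exact ⟨(continuous_fst K L).measurable.comp hf, (continuous_snd K L).measurable.comp hf⟩
  · rintro ⟨h₁, h₂⟩
    have h12 : Measurable[_, Prod.instMeasurableSpace]
        (fun x => ((fst K L (f x), snd K L (f x)) : relNormOneIdeles K L × relNormOneIdeles K L)) := h₁.prodMk h₂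
    rw [measurable_iff_comap_le] at h12 ⊢
    rw [h]
    exact h12

/-- `[U(W₁)] × [U(W₂)]` with the product σ-algebra is a Borel space (this is where second countability enters). -/
instance borelSpace_quotProd :
    BorelSpace ((relNormOneIdeles K L ⧸ relNormOneRat K L) × (relNormOneIdeles K L ⧸ relNormOneRat K L)) :=
  inferInstance

end SeesawTorus

end SecondCountable

/-! ## §2  `dt = du₁ du₂` -/

namespace SeesawTorus

section ProductMeasure

variable (K L : Type) [Field K] [Field L] [NumberField L] [Algebra K L] [FiniteDimensional K L]
variable [SecondCountableTopology (AdeleRing (𝓞 L) L)]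

/-- `quotEquiv` as a measurable equivalence `[T] ≃ᵐ [U(W₁)] × [U(W₂)]`. -/
def quotMeasurableEquiv : (SeesawTorus K L ⧸ rat K L) ≃ᵐ
    (relNormOneIdeles K L ⧸ relNormOneRat K L) × (relNormOneIdeles K L ⧸ relNormOneRat K L) :=
  (quotEquiv K L).toHomeomorph.toMeasurableEquiv

/-- (Ported verbatim from the HodgeCMPerL package; no docstring in the source.) -/
@[simp] theorem quotMeasurableEquiv_apply (q : SeesawTorus K L ⧸ rat K L) :
    quotMeasurableEquiv K L q = (quotFst K L q, quotSnd K L q) := rfl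

/-- (Ported verbatim from the HodgeCMPerL package; no docstring in the source.) -/
theorem coe_quotMeasurableEquiv : ⇑(quotMeasurableEquiv K L) = ⇑(quotEquiv K L) := rfl

/-- (Ported verbatim from the HodgeCMPerL package; no docstring in the source.) -/
theorem quotMeasurableEquiv_symm_apply
    (p : (relNormOneIdeles K L ⧸ relNormOneRat K L) × (relNormOneIdeles K L ⧸ relNormOneRat K L)) :
    (quotMeasurableEquiv K L).symm p = quotInl K L p.1 * quotInr K L p.2 := rfl

/-- `du₁ du₂`, the product of the two Haar probability measures, is a Haar probability measure on
`[U(W₁)] × [U(W₂)]`. -/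
instance isHaarMeasure_prod :
    ((probHaarRelNormOneQuot K L).prod (probHaarRelNormOneQuot K L)).IsHaarMeasure :=
  inferInstance

/-- (Ported verbatim from the HodgeCMPerL package; no docstring in the source.) -/
instance isProbabilityMeasure_prod :
    IsProbabilityMeasure ((probHaarRelNormOneQuot K L).prod (probHaarRelNormOneQuot K L)) :=
  inferInstance

/-- **`dt = du₁ du₂`** (PerL l. 335), pinned on the group isomorphism `quotMulEquiv`: the Haar probability measure
of `[T]` maps to the product of the Haar probability measures of the factors (uniqueness of Haar probability
measures). -/
theorem map_quotMulEquiv_probHaarQuot :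
    (probHaarQuot K L).map (quotMulEquiv K L) = (probHaarRelNormOneQuot K L).prod (probHaarRelNormOneQuot K L) := by
  haveI : ((probHaarQuot K L).map (quotMulEquiv K L)).IsHaarMeasure :=
    MulEquiv.isHaarMeasure_map
      (H := (relNormOneIdeles K L ⧸ relNormOneRat K L) × (relNormOneIdeles K L ⧸ relNormOneRat K L))
      (probHaarQuot K L) (quotMulEquiv K L) (continuous_quotMulEquiv K L) (continuous_quotMulEquiv_symm K L)
  haveI : IsProbabilityMeasure ((probHaarQuot K L).map (quotMulEquiv K L)) :=
    Measure.isProbabilityMeasure_map (continuous_quotMulEquiv K L).measurable.aemeasurable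
  exact Measure.isHaarMeasure_eq_of_isProbabilityMeasure _ _

/-- `dt = du₁ du₂` along the topological-group isomorphism `quotEquiv : [T] ≃ₜ* [U(W₁)] × [U(W₂)]`. -/
theorem map_quotEquiv_probHaarQuot :
    (probHaarQuot K L).map (quotEquiv K L) = (probHaarRelNormOneQuot K L).prod (probHaarRelNormOneQuot K L) :=
  map_quotMulEquiv_probHaarQuot K L

/-- (Ported verbatim from the HodgeCMPerL package; no docstring in the source.) -/
theorem map_quotMeasurableEquiv_probHaarQuot :
    (probHaarQuot K L).map (quotMeasurableEquiv K L) =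
      (probHaarRelNormOneQuot K L).prod (probHaarRelNormOneQuot K L) :=
  map_quotMulEquiv_probHaarQuot K L

/-- (Ported verbatim from the HodgeCMPerL package; no docstring in the source.) -/
theorem measurePreserving_quotMeasurableEquiv :
    MeasurePreserving (quotMeasurableEquiv K L) (probHaarQuot K L)
      ((probHaarRelNormOneQuot K L).prod (probHaarRelNormOneQuot K L)) :=
  ⟨(quotMeasurableEquiv K L).measurable, map_quotMeasurableEquiv_probHaarQuot K L⟩

/-- (Ported verbatim from the HodgeCMPerL package; no docstring in the source.) -/
theorem measurePreserving_quotEquiv :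
    MeasurePreserving (quotEquiv K L) (probHaarQuot K L)
      ((probHaarRelNormOneQuot K L).prod (probHaarRelNormOneQuot K L)) :=
  measurePreserving_quotMeasurableEquiv K L

/-- (Ported verbatim from the HodgeCMPerL package; no docstring in the source.) -/
theorem measurePreserving_quotMeasurableEquiv_symm :
    MeasurePreserving (quotMeasurableEquiv K L).symm
      ((probHaarRelNormOneQuot K L).prod (probHaarRelNormOneQuot K L)) (probHaarQuot K L) :=
  (measurePreserving_quotMeasurableEquiv K L).symm _

/-- (Ported verbatim from the HodgeCMPerL package; no docstring in the source.) -/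
theorem measurePreserving_quotEquiv_symm :
    MeasurePreserving (quotEquiv K L).symm ((probHaarRelNormOneQuot K L).prod (probHaarRelNormOneQuot K L))
      (probHaarQuot K L) :=
  measurePreserving_quotMeasurableEquiv_symm K L

/-- The inverse direction: `du₁ du₂` pushed to `[T]` is `dt`. -/
theorem map_quotEquiv_symm_prod :
    ((probHaarRelNormOneQuot K L).prod (probHaarRelNormOneQuot K L)).map (quotEquiv K L).symm = probHaarQuot K L :=
  (measurePreserving_quotEquiv_symm K L).map_eq

/-- The same with the inverse written out: `(u₁, u₂) ↦ quotInl u₁ * quotInr u₂` pushes `du₁ du₂` to `dt`. -/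
theorem map_inl_mul_inr_prod :
    ((probHaarRelNormOneQuot K L).prod (probHaarRelNormOneQuot K L)).map
        (fun p => quotInl K L p.1 * quotInr K L p.2) = probHaarQuot K L :=
  (measurePreserving_quotEquiv_symm K L).map_eq

/-- (Ported verbatim from the HodgeCMPerL package; no docstring in the source.) -/
theorem measurePreserving_quotFst :
    MeasurePreserving (quotFst K L) (probHaarQuot K L) (probHaarRelNormOneQuot K L) :=
  (measurePreserving_fst (μ := probHaarRelNormOneQuot K L) (ν := probHaarRelNormOneQuot K L)).comp
    (measurePreserving_quotMeasurableEquiv K L)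

/-- (Ported verbatim from the HodgeCMPerL package; no docstring in the source.) -/
theorem measurePreserving_quotSnd :
    MeasurePreserving (quotSnd K L) (probHaarQuot K L) (probHaarRelNormOneQuot K L) :=
  (measurePreserving_snd (μ := probHaarRelNormOneQuot K L) (ν := probHaarRelNormOneQuot K L)).comp
    (measurePreserving_quotMeasurableEquiv K L)

/-- The marginal of `dt` under `[T] → [U(W₁)]` is `du₁` … -/
theorem map_quotFst_probHaarQuot : (probHaarQuot K L).map (quotFst K L) = probHaarRelNormOneQuot K L :=
  (measurePreserving_quotFst K L).map_eq

/-- … and under `[T] → [U(W₂)]` it is `du₂`. -/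
theorem map_quotSnd_probHaarQuot : (probHaarQuot K L).map (quotSnd K L) = probHaarRelNormOneQuot K L :=
  (measurePreserving_quotSnd K L).map_eq

end ProductMeasure

/-! ## §3  Fubini on `[T]` -/

section Fubini

variable (K L : Type) [Field K] [Field L] [NumberField L] [Algebra K L] [FiniteDimensional K L]
variable [SecondCountableTopology (AdeleRing (𝓞 L) L)]
variable {E : Type} [NormedAddCommGroup E] [NormedSpace ℝ E]

/-- Change of variables along `[T] ≃ [U(W₁)] × [U(W₂)]`: `∫_{[T]} g(t₁, t₂) dt = ∫ g d(du₁ du₂)` (any `g`). -/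
theorem integral_comp_quotEquiv
    (g : (relNormOneIdeles K L ⧸ relNormOneRat K L) × (relNormOneIdeles K L ⧸ relNormOneRat K L) → E) :
    ∫ q, g (quotFst K L q, quotSnd K L q) ∂probHaarQuot K L =
      ∫ p, g p ∂(probHaarRelNormOneQuot K L).prod (probHaarRelNormOneQuot K L) :=
  (measurePreserving_quotMeasurableEquiv K L).integral_comp (quotMeasurableEquiv K L).measurableEmbedding g

/-- The same read on `[T]`: `∫_{[T]} F dt = ∫ F(u₁ u₂) d(du₁ du₂)` (any `F`; `u₁u₂ := quotInl u₁ * quotInr u₂`). -/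
theorem integral_eq_integral_prod (F : SeesawTorus K L ⧸ rat K L → E) :
    ∫ q, F q ∂probHaarQuot K L =
      ∫ p, F (quotInl K L p.1 * quotInr K L p.2) ∂(probHaarRelNormOneQuot K L).prod (probHaarRelNormOneQuot K L) := by
  rw [← (measurePreserving_quotMeasurableEquiv_symm K L).integral_comp
    (quotMeasurableEquiv K L).symm.measurableEmbedding F]
  rfl

omit [NormedSpace ℝ E] in
/-- Integrability transfers along `[T] ≃ [U(W₁)] × [U(W₂)]`. -/
theorem integrable_prod_iff (F : SeesawTorus K L ⧸ rat K L → E) :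
    Integrable (fun p : (relNormOneIdeles K L ⧸ relNormOneRat K L) × (relNormOneIdeles K L ⧸ relNormOneRat K L) =>
        F (quotInl K L p.1 * quotInr K L p.2)) ((probHaarRelNormOneQuot K L).prod (probHaarRelNormOneQuot K L)) ↔
      Integrable F (probHaarQuot K L) := by
  have h := (measurePreserving_quotMeasurableEquiv_symm K L).integrable_comp_emb
    (quotMeasurableEquiv K L).symm.measurableEmbedding (g := F)
  exact h

omit [SecondCountableTopology (AdeleRing (𝓞 L) L)] [NormedSpace ℝ E] in
/-- A continuous function on the compact group `[T]` is `dt`-integrable. -/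
theorem integrable_of_continuous {F : SeesawTorus K L ⧸ rat K L → E} (hF : Continuous F) :
    Integrable F (probHaarQuot K L) :=
  hF.integrable_of_hasCompactSupport (HasCompactSupport.of_compactSpace F)

/-- **PerL l. 335 on the genuine torus — "integrating over `[T] = [U(W₁)]×[U(W₂)]`" (Fubini):**
`∫_{[T]} F dt = ∫_{[U(W₁)]} ∫_{[U(W₂)]} F(u₁u₂) du₂ du₁` for every `dt`-integrable `F`. -/
theorem integral_eq_integral_integral (F : SeesawTorus K L ⧸ rat K L → E) (hF : Integrable F (probHaarQuot K L)) :
    ∫ q, F q ∂probHaarQuot K L =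
      ∫ u₁, ∫ u₂, F (quotInl K L u₁ * quotInr K L u₂) ∂probHaarRelNormOneQuot K L ∂probHaarRelNormOneQuot K L := by
  rw [integral_eq_integral_prod, integral_prod _ ((integrable_prod_iff K L F).mpr hF)]

/-- The other order: `∫_{[T]} F dt = ∫_{[U(W₂)]} ∫_{[U(W₁)]} F(u₁u₂) du₁ du₂`. -/
theorem integral_eq_integral_integral_symm (F : SeesawTorus K L ⧸ rat K L → E)
    (hF : Integrable F (probHaarQuot K L)) :
    ∫ q, F q ∂probHaarQuot K L =
      ∫ u₂, ∫ u₁, F (quotInl K L u₁ * quotInr K L u₂) ∂probHaarRelNormOneQuot K L ∂probHaarRelNormOneQuot K L := by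
  rw [integral_eq_integral_prod, integral_prod_symm _ ((integrable_prod_iff K L F).mpr hF)]

/-- "(all integrals over compact sets of continuous functions)": the continuous case. -/
theorem integral_eq_integral_integral_of_continuous (F : SeesawTorus K L ⧸ rat K L → E) (hF : Continuous F) :
    ∫ q, F q ∂probHaarQuot K L =
      ∫ u₁, ∫ u₂, F (quotInl K L u₁ * quotInr K L u₂) ∂probHaarRelNormOneQuot K L ∂probHaarRelNormOneQuot K L :=
  integral_eq_integral_integral K L F (integrable_of_continuous K L hF)

/-- Functions of one variable: `∫_{[T]} f(t₁) dt = ∫_{[U(W₁)]} f du₁` … -/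
theorem integral_comp_quotFst (f : relNormOneIdeles K L ⧸ relNormOneRat K L → E) :
    ∫ q, f (quotFst K L q) ∂probHaarQuot K L = ∫ u, f u ∂probHaarRelNormOneQuot K L := by
  have h := integral_comp_quotEquiv K L (fun p => f p.1)
  simp only at h
  rw [h, integral_fun_fst, probReal_univ, one_smul]

/-- … and `∫_{[T]} f(t₂) dt = ∫_{[U(W₂)]} f du₂`. -/
theorem integral_comp_quotSnd (f : relNormOneIdeles K L ⧸ relNormOneRat K L → E) :
    ∫ q, f (quotSnd K L q) ∂probHaarQuot K L = ∫ u, f u ∂probHaarRelNormOneQuot K L := by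
  have h := integral_comp_quotEquiv K L (fun p => f p.2)
  simp only at h
  rw [h, integral_fun_snd, probReal_univ, one_smul]

variable {K L}

omit [SecondCountableTopology (AdeleRing (𝓞 L) L)] in
/-- `χ₁₂(u₁u₂) = χ′₁(u₁) χ′₂(u₂)` for `χ₁₂ = χ′₁ ⊠ χ′₂` (pointwise, as complex numbers). -/
theorem toComplexChar_charPair_inl_mul_inr
    (ξ₁ ξ₂ : PontryaginDual (relNormOneIdeles K L ⧸ relNormOneRat K L))
    (u₁ u₂ : relNormOneIdeles K L ⧸ relNormOneRat K L) :
    toComplexChar (charPair ξ₁ ξ₂) (quotInl K L u₁ * quotInr K L u₂) = toComplexChar ξ₁ u₁ * toComplexChar ξ₂ u₂ := by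
  have h₁ : toComplexChar (charPair ξ₁ ξ₂) (quotInl K L u₁) = toComplexChar ξ₁ u₁ :=
    congrArg (fun z : Circle => (z : ℂ)) (charFst_charPair_apply ξ₁ ξ₂ u₁)
  have h₂ : toComplexChar (charPair ξ₁ ξ₂) (quotInr K L u₂) = toComplexChar ξ₂ u₂ :=
    congrArg (fun z : Circle => (z : ℂ)) (charSnd_charPair_apply ξ₁ ξ₂ u₂)
  rw [map_mul (toComplexChar (charPair ξ₁ ξ₂)), h₁, h₂]

/-- A character is a bounded continuous weight: `F · ξ` is integrable when `F` is. -/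
theorem integrable_mul_toComplexChar {G : Type} [Group G] [TopologicalSpace G] [MeasurableSpace G]
    [OpensMeasurableSpace G] {μ : Measure G} {F : G → ℂ} (hF : Integrable F μ) (ξ : PontryaginDual G) :
    Integrable (fun g => F g * toComplexChar ξ g) μ :=
  hF.mul_bdd (c := 1) ((continuous_subtype_val.comp ξ.continuous).aestronglyMeasurable)
    (Filter.Eventually.of_forall fun g => (Circle.norm_coe (ξ g)).le)

/-- **The toric period over the genuine `[T]` as an iterated integral** (PerL l. 306 `P_{T,χ}(F) = ∫_{[T]} F χ dt`
with `χ = χ₁₂ = χ′₁ ⊠ χ′₂`, and l. 335):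
`∫_{[T]} F(t) χ₁₂(t) dt = ∫_{[U(W₁)]} ∫_{[U(W₂)]} F(u₁u₂) χ′₁(u₁) χ′₂(u₂) du₂ du₁` for `dt`-integrable `F`. -/
theorem integral_mul_charPair (F : SeesawTorus K L ⧸ rat K L → ℂ) (hF : Integrable F (probHaarQuot K L))
    (ξ₁ ξ₂ : PontryaginDual (relNormOneIdeles K L ⧸ relNormOneRat K L)) :
    ∫ q, F q * toComplexChar (charPair ξ₁ ξ₂) q ∂probHaarQuot K L =
      ∫ u₁, ∫ u₂, F (quotInl K L u₁ * quotInr K L u₂) * (toComplexChar ξ₁ u₁ * toComplexChar ξ₂ u₂)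
        ∂probHaarRelNormOneQuot K L ∂probHaarRelNormOneQuot K L := by
  rw [integral_eq_integral_integral K L _ (integrable_mul_toComplexChar hF (charPair ξ₁ ξ₂))]
  simp only [toComplexChar_charPair_inl_mul_inr]

/-- The continuous case of `integral_mul_charPair`. -/
theorem integral_mul_charPair_of_continuous (F : SeesawTorus K L ⧸ rat K L → ℂ) (hF : Continuous F)
    (ξ₁ ξ₂ : PontryaginDual (relNormOneIdeles K L ⧸ relNormOneRat K L)) :
    ∫ q, F q * toComplexChar (charPair ξ₁ ξ₂) q ∂probHaarQuot K L =
      ∫ u₁, ∫ u₂, F (quotInl K L u₁ * quotInr K L u₂) * (toComplexChar ξ₁ u₁ * toComplexChar ξ₂ u₂)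
        ∂probHaarRelNormOneQuot K L ∂probHaarRelNormOneQuot K L :=
  integral_mul_charPair F (integrable_of_continuous K L hF) ξ₁ ξ₂

/-- Every character `ξ` of `[T]` in the form PerL uses it: `∫_{[T]} F ξ dt = ∫∫ F(u₁u₂) χ′₁(u₁) χ′₂(u₂) du₂ du₁` with
`(χ′₁, χ′₂) := ξ` (`charFst ξ`, `charSnd ξ`). -/
theorem integral_mul_char (F : SeesawTorus K L ⧸ rat K L → ℂ) (hF : Integrable F (probHaarQuot K L))
    (ξ : PontryaginDual (SeesawTorus K L ⧸ rat K L)) :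
    ∫ q, F q * toComplexChar ξ q ∂probHaarQuot K L =
      ∫ u₁, ∫ u₂, F (quotInl K L u₁ * quotInr K L u₂) *
        (toComplexChar (charFst ξ) u₁ * toComplexChar (charSnd ξ) u₂)
        ∂probHaarRelNormOneQuot K L ∂probHaarRelNormOneQuot K L := by
  rw [← integral_mul_charPair F hF]
  rw [charPair_charFst_charSnd]

/-- Product integrands split: `∫_{[T]} f(t₁) g(t₂) dt = (∫_{[U(W₁)]} f du₁)(∫_{[U(W₂)]} g du₂)` (any `f, g`). -/
theorem integral_fst_mul_snd (f g : relNormOneIdeles K L ⧸ relNormOneRat K L → ℂ) :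
    ∫ q, f (quotFst K L q) * g (quotSnd K L q) ∂probHaarQuot K L =
      (∫ u, f u ∂probHaarRelNormOneQuot K L) * (∫ u, g u ∂probHaarRelNormOneQuot K L) := by
  rw [← integral_prod_mul]
  exact integral_comp_quotEquiv K L (fun p => f p.1 * g p.2)

end Fubini

end SeesawTorus

end NumberField

end
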